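import Summits.ValiantsHypothesis.ValiantsHypothesis.Theses.SummationBits
import Summits.ValiantsHypothesis.ValiantsHypothesis.Theorems.SummationBitsPositiveWitnessConstructionPrelims
import Literature.Barriers.ValiantsHypothesis.MonotoneGapPermanentLower

/-!
# Route SummationBits, item `PositiveWitnessConstruction` (stmt-ValiantsHypothesis-10489):
the positive rung of the summation-bits dial, construction half (Theorem A of the card, `C = 5`)

**Item** (`Summit.ValiantsHypothesis.ValiantsHypothesis.Theses.SummationBits.PositiveWitnessConstruction`):
there is `C` such that for every `n ≥ 4` some `g ∈ ℝ≥0[X_{ij}]` with a Jerrum–Snir monotone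
computation (fan-in two, all sum coefficients `1`) of size `≤ n^C + C` has `mon(g) ⊆ mon(per_n)` and
`|mon(g)| ≥ 2^{n·log₂log₂ n - C·n}`.  We prove it with `C = 5`
(`PositiveWitnessConstruction_proof`, the last declaration).

**Witness.** `k = ⌊log₂ n⌋ ≥ 2`, `n = qk + r` (`r < k`), and
`E : (Fin q × Fin k) ⊕ Fin r ≃ Fin n` the decomposition into `q` consecutive blocks and `r`
left-over indices.  The witness is the block-diagonal product

  `g = (∏_{b : Fin q} per (X_{ij})_{i, j ∈ block b}) · ∏_{x : Fin r} X_{(x, x)}`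

(block permanents = the generic permanent `perPoly (Fin k) ℝ≥0` renamed into the block).  Each
block permanent is computed by the tree's permanental Laplace expansion
(`JerrumSnir.laplaceCircuit`, J. ACM 29 (1982) §4.3, `≤ k·2^k ≤ n·log₂ n` gates, prelims file), so
`g` has a monotone computation of size `≤ q·k·2^k + q + r + 1 ≤ n² + n + 1 ≤ n^5 + 5`.

**Monomials** (this file, for an arbitrary finite index type `α` in place of `Fin n`).  Over `ℝ≥0`
there is no cancellation (`JerrumSnir.support_mul_eq`), so the monomials of `g` are exactly the
permutation monomials `permMonomial τ` of the block-diagonal permutations `τ` (identity on the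
left-over indices):

* `support_blockWitness_subset` : `mon(g) ⊆ mon(per_α)`;
* `factorial_pow_le_card_support_blockWitness` : `(k!)^q ≤ |mon(g)|` (the block-diagonal
  permutations `σ ↦ E ∘ (⊕_b σ_b ⊕ id) ∘ E⁻¹`, `σ : Fin q → 𝔖_k`, inject).

**Count.** `(k!)^q ≥ (k/3)^{kq} ≥ …`: precisely `(log₂ n)^n < (k+1)^n ≤ 2^{5n} (k!)^q`
(prelims), i.e. `|mon(g)| ≥ 2^{n log₂log₂ n - 5n}`.

Everything is stated for the explicit product (no new definitions).  Sources: Jerrum–Snir 1982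
§4.3 (the Laplace circuit; the calibration `ν⁺(per_n) = n log₂ n - n log₂log₂ n ± O(n)` of the
route's card), the permutation monomials `permMonomial`, `coeff_permMonomial_perPoly` of
`PermanentIrreducible.lean`, the positivity calculus of `MonotoneGapParseTrees.lean` (JS §2.2).
-/

noncomputable section

namespace Summit.ValiantsHypothesis.Theorems.SummationBits

open Literature.Computability.AlgebraicComplexity MvPolynomial Finset
open Literature.Barriers.ValiantsHypothesis
open scoped NNReal Pointwise

universe u

/-! ### Monomials of finite products -/

/-- A monomial of a finite product of polynomials is a sum of monomials of the factors (any
commutative semiring). [folklore] -/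
theorem exists_eq_sum_of_mem_support_prod {ι : Type*} {σ : Type*} {R : Type*} [CommSemiring R]
    [DecidableEq ι] [DecidableEq σ] (s : Finset ι) (f : ι → MvPolynomial σ R) {m : σ →₀ ℕ}
    (hm : m ∈ (∏ i ∈ s, f i).support) :
    ∃ u : ι → σ →₀ ℕ, (∀ i ∈ s, u i ∈ (f i).support) ∧ m = ∑ i ∈ s, u i := by
  induction s using Finset.induction_on generalizing m with
  | empty =>
    refine ⟨fun _ => 0, by simp, ?_⟩
    rw [Finset.prod_empty, mem_support_iff, coeff_one] at hm
    rw [Finset.sum_empty]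
    by_contra h
    exact hm (if_neg (Ne.symm h))
  | insert a s ha ih =>
    rw [Finset.prod_insert ha] at hm
    obtain ⟨v, hv, w, hw, rfl⟩ := Finset.mem_add.1 (support_mul _ _ hm)
    obtain ⟨u, hu, rfl⟩ := ih hw
    refine ⟨Function.update u a v, ?_, ?_⟩
    · intro i hi
      rcases Finset.mem_insert.1 hi with rfl | hi
      · rw [Function.update_self]; exact hv
      · rw [Function.update_of_ne (ne_of_mem_of_not_mem hi ha)]; exact hu i hi
    · rw [Finset.sum_insert ha, Function.update_self]
      congr 1
      exact Finset.sum_congr rfl fun i hi => by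
        rw [Function.update_of_ne (ne_of_mem_of_not_mem hi ha)]

/-- Over `ℝ≥0` (no cancellation) a sum of monomials of the factors is a monomial of the product.
[cite: JerrumSnir1982, §2.2] -/
theorem sum_mem_support_prod {ι : Type*} {σ : Type*} [DecidableEq ι] [DecidableEq σ]
    (s : Finset ι) (f : ι → MvPolynomial σ ℝ≥0) (u : ι → σ →₀ ℕ)
    (hu : ∀ i ∈ s, u i ∈ (f i).support) : (∑ i ∈ s, u i) ∈ (∏ i ∈ s, f i).support := by
  induction s using Finset.induction_on with
  | empty => simp
  | insert a s ha ih =>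
    rw [Finset.sum_insert ha, Finset.prod_insert ha, JerrumSnir.support_mul_eq]
    exact Finset.add_mem_add (hu a (Finset.mem_insert_self _ _))
      (ih fun i hi => hu i (Finset.mem_insert_of_mem hi))

/-- A product of variables is the monomial with exponent vector the sum of the unit vectors, with
coefficient `1`. [folklore] -/
theorem prod_X_eq_monomial {ι : Type*} {σ : Type*} {R : Type*} [CommSemiring R] [Fintype ι]
    (c : ι → σ) : (∏ x, X (c x) : MvPolynomial σ R) = monomial (∑ x, Finsupp.single (c x) 1) 1 := by
  rw [monomial_sum_one]
  rfl

/-! ### Block-diagonal permutation monomials -/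

section Blocks

variable {α : Type u} [Fintype α] [DecidableEq α] {q k r : ℕ}

omit [Fintype α] [DecidableEq α] in
/-- The embedding of block `b` into the cells `α × α` is injective. [folklore] -/
theorem prodMap_block_injective (E : (Fin q × Fin k) ⊕ Fin r ≃ α) (b : Fin q) :
    Function.Injective
      (Prod.map (fun i : Fin k => E (Sum.inl (b, i))) (fun i : Fin k => E (Sum.inl (b, i)))) := by
  have h : Function.Injective (fun i : Fin k => E (Sum.inl (b, i))) := by
    intro i j hij
    simpa using E.injective hij
  exact h.prodMap h

omit [Fintype α] [DecidableEq α] in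
/-- A permutation monomial of `𝔖_k` moved into block `b`: `Σ_i e_{(ρ (π i), ρ i)}` with
`ρ = E (inl (b, ·))`. [folklore] -/
theorem mapDomain_prodMap_permMonomial (ρ : Fin k → α) (π : Equiv.Perm (Fin k)) :
    Finsupp.mapDomain (Prod.map ρ ρ) (permMonomial π) =
      ∑ i, Finsupp.single (ρ (π i), ρ i) 1 := by
  unfold permMonomial
  rw [Finsupp.mapDomain_finsetSum]
  simp [Finsupp.mapDomain_single]

omit [DecidableEq α] in
/-- **The permutation monomial of a block-diagonal permutation.** For `σ : Fin q → 𝔖_k` let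
`τ_σ = E ∘ (⊕_b σ_b ⊕ id) ∘ E⁻¹ ∈ 𝔖_α`; then `μ_{τ_σ}` is the sum of the block monomials
`μ_{σ_b}` moved into the blocks plus the diagonal cells of the left-over indices. [folklore] -/
theorem permMonomial_blockPerm (E : (Fin q × Fin k) ⊕ Fin r ≃ α) (σ : Fin q → Equiv.Perm (Fin k)) :
    permMonomial (E.permCongr (Equiv.sumCongr (Equiv.prodCongrRight σ) (Equiv.refl (Fin r)))) =
      (∑ b, Finsupp.mapDomain
          (Prod.map (fun i : Fin k => E (Sum.inl (b, i))) (fun i : Fin k => E (Sum.inl (b, i))))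
          (permMonomial (σ b))) +
        ∑ x : Fin r, Finsupp.single (E (Sum.inr x), E (Sum.inr x)) 1 := by
  simp_rw [mapDomain_prodMap_permMonomial]
  unfold permMonomial
  rw [← Equiv.sum_comp E, Fintype.sum_sum_type, Fintype.sum_prod_type]
  simp [Equiv.permCongr_apply]

omit [Fintype α] [DecidableEq α] in
/-- The block-diagonal permutation `σ ↦ τ_σ` is injective in `σ`. [folklore] -/
theorem blockPerm_injective (E : (Fin q × Fin k) ⊕ Fin r ≃ α) :
    Function.Injective (fun σ : Fin q → Equiv.Perm (Fin k) =>
      E.permCongr (Equiv.sumCongr (Equiv.prodCongrRight σ) (Equiv.refl (Fin r)))) := by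
  intro σ₁ σ₂ h
  have h' := E.permCongr.injective h
  funext b
  refine Equiv.ext fun i => ?_
  have := Equiv.congr_fun h' (Sum.inl (b, i))
  simpa using this

/-- **`mon(g) ⊆ mon(per)`**: every monomial of the block witness
`g = (∏_b per(block b)) · ∏_x X_{(x,x)}` is a permutation monomial of `α`. [folklore] -/
theorem support_blockWitness_subset (E : (Fin q × Fin k) ⊕ Fin r ≃ α) :
    ((∏ b : Fin q, rename
          (Prod.map (fun i : Fin k => E (Sum.inl (b, i))) (fun i : Fin k => E (Sum.inl (b, i))))
          (perPoly (Fin k) ℝ≥0)) *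
        ∏ x : Fin r, (X (E (Sum.inr x), E (Sum.inr x)) : MvPolynomial (α × α) ℝ≥0)).support ⊆
      (perPoly α ℝ≥0).support := by
  intro m hm
  obtain ⟨u, hu, v, hv, rfl⟩ := Finset.mem_add.1 (support_mul _ _ hm)
  obtain ⟨w, hw, rfl⟩ := exists_eq_sum_of_mem_support_prod _ _ hu
  -- each block monomial is a moved permutation monomial
  have hblock : ∀ b : Fin q, ∃ π : Equiv.Perm (Fin k),
      Finsupp.mapDomain
        (Prod.map (fun i : Fin k => E (Sum.inl (b, i))) (fun i : Fin k => E (Sum.inl (b, i))))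
        (permMonomial π) = w b := by
    intro b
    have hb := hw b (Finset.mem_univ b)
    rw [support_rename_of_injective (prodMap_block_injective E b), Finset.mem_image] at hb
    obtain ⟨d, hd, hdw⟩ := hb
    obtain ⟨π, rfl⟩ := exists_permMonomial_eq_of_coeff_perPoly_ne_zero ℝ≥0 (mem_support_iff.1 hd)
    exact ⟨π, hdw⟩
  choose σ hσ using hblock
  -- the left-over factor is a single monomial
  rw [prod_X_eq_monomial, support_monomial, if_neg one_ne_zero, Finset.mem_singleton] at hv
  subst hv
  rw [show (∑ b, w b) = ∑ b, Finsupp.mapDomain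
      (Prod.map (fun i : Fin k => E (Sum.inl (b, i))) (fun i : Fin k => E (Sum.inl (b, i))))
      (permMonomial (σ b)) from Finset.sum_congr rfl fun b _ => (hσ b).symm,
    ← permMonomial_blockPerm E σ, mem_support_iff, coeff_permMonomial_perPoly]
  exact one_ne_zero

/-- Every block-diagonal permutation monomial `μ_{τ_σ}` IS a monomial of the block witness (no
cancellation over `ℝ≥0`). [folklore] -/
theorem permMonomial_blockPerm_mem_support (E : (Fin q × Fin k) ⊕ Fin r ≃ α)
    (σ : Fin q → Equiv.Perm (Fin k)) :
    permMonomial (E.permCongr (Equiv.sumCongr (Equiv.prodCongrRight σ) (Equiv.refl (Fin r)))) ∈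
      ((∏ b : Fin q, rename
          (Prod.map (fun i : Fin k => E (Sum.inl (b, i))) (fun i : Fin k => E (Sum.inl (b, i))))
          (perPoly (Fin k) ℝ≥0)) *
        ∏ x : Fin r, (X (E (Sum.inr x), E (Sum.inr x)) : MvPolynomial (α × α) ℝ≥0)).support := by
  rw [permMonomial_blockPerm E σ, JerrumSnir.support_mul_eq]
  refine Finset.add_mem_add ?_ ?_
  · refine sum_mem_support_prod _ _ _ fun b _ => ?_
    rw [support_rename_of_injective (prodMap_block_injective E b)]
    refine Finset.mem_image_of_mem _ (mem_support_iff.2 ?_)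
    rw [coeff_permMonomial_perPoly]
    exact one_ne_zero
  · rw [prod_X_eq_monomial, support_monomial, if_neg one_ne_zero]
    exact Finset.mem_singleton_self _

/-- **`(k!)^q ≤ |mon(g)|`**: the block witness has at least `(k!)^q` monomials (the monomials of
the `(k!)^q` block-diagonal permutations are distinct). [folklore] -/
theorem factorial_pow_le_card_support_blockWitness (E : (Fin q × Fin k) ⊕ Fin r ≃ α) :
    k.factorial ^ q ≤
      ((∏ b : Fin q, rename
          (Prod.map (fun i : Fin k => E (Sum.inl (b, i))) (fun i : Fin k => E (Sum.inl (b, i))))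
          (perPoly (Fin k) ℝ≥0)) *
        ∏ x : Fin r, (X (E (Sum.inr x), E (Sum.inr x)) : MvPolynomial (α × α) ℝ≥0)).support.card := by
  set Φ : (Fin q → Equiv.Perm (Fin k)) → (α × α →₀ ℕ) := fun σ =>
    permMonomial (E.permCongr (Equiv.sumCongr (Equiv.prodCongrRight σ) (Equiv.refl (Fin r))))
    with hΦ
  have hinj : Function.Injective Φ := permMonomial_injective.comp (blockPerm_injective E)
  calc k.factorial ^ q = Fintype.card (Fin q → Equiv.Perm (Fin k)) := by
        simp [Fintype.card_perm]
    _ = (Finset.univ.image Φ).card := by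
        rw [Finset.card_image_of_injective _ hinj, Finset.card_univ]
    _ ≤ _ := by
        refine Finset.card_le_card (Finset.image_subset_iff.2 fun σ _ => ?_)
        exact permMonomial_blockPerm_mem_support E σ

end Blocks

/-! ### The item -/

section Main

/-- **Theorem A of card summation-bits-ladder, construction half** (item
stmt-ValiantsHypothesis-10489, `PositiveWitnessConstruction`, with `C = 5`): for every `n ≥ 4` there
is a polynomial `g ∈ ℝ≥0[X_{ij}]` with a Jerrum–Snir monotone computation (plain fan-in-two circuit
over `ℝ≥0`) of size `≤ n^5 + 5`, whose monomials are permutation monomials of `per_n`, and which has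
at least `2^{n log₂log₂ n - 5n}` monomials.  Witness: `k = ⌊log₂ n⌋`, `n = qk + r`; `g` is the
product of the `q` block permanents of the consecutive `k × k` diagonal blocks (each computed by the
permanental Laplace expansion, `≤ k·2^k ≤ n log₂ n` gates) and of the `r` left-over diagonal
variables; `|mon(g)| ≥ (k!)^q ≥ (log₂ n)^n / 2^{5n}`. [cite: JerrumSnir1982, §4.3 (p. 889)] -/
theorem PositiveWitnessConstruction_proof :
    Summit.ValiantsHypothesis.ValiantsHypothesis.Theses.SummationBits.PositiveWitnessConstruction := by
  unfold Summit.ValiantsHypothesis.ValiantsHypothesis.Theses.SummationBits.PositiveWitnessConstruction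
  refine ⟨5, fun n hn => ?_⟩
  -- parameters: k = ⌊log₂ n⌋ ≥ 2, n = q k + r with r < k
  obtain ⟨k, hk⟩ : ∃ k, k = Nat.log 2 n := ⟨_, rfl⟩
  have hk2 : 2 ≤ k := by
    rw [hk]; exact Nat.le_log_of_pow_le (by norm_num) (by norm_num; omega)
  have hk0 : 0 < k := by omega
  have h2k : 2 ^ k ≤ n := by rw [hk]; exact Nat.pow_log_le_self 2 (by omega)
  have hlog : Real.logb 2 (n : ℝ) < (k : ℝ) + 1 := by
    rw [hk]; exact logb_lt_natLog_add_one (by omega)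
  obtain ⟨q, hq⟩ : ∃ q, q = n / k := ⟨_, rfl⟩
  obtain ⟨r, hr⟩ : ∃ r, r = n % k := ⟨_, rfl⟩
  have hrk : r < k := by rw [hr]; exact Nat.mod_lt n hk0
  have hqr : q * k + r = n := by rw [hq, hr]; exact Nat.div_add_mod' n k
  -- the decomposition of `Fin n` into `q` blocks of size `k` and `r` left-over indices
  obtain ⟨E, -⟩ : ∃ _E : (Fin q × Fin k) ⊕ Fin r ≃ Fin n, True :=
    ⟨(Equiv.sumCongr finProdFinEquiv (Equiv.refl (Fin r))).trans
      (finSumFinEquiv.trans (finCongr hqr)), trivial⟩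
  -- the witness and its monotone computation
  have hcomp : ∃ P : ArithCircuit ℝ≥0 (Fin n × Fin n), IsMonotoneComputation P
      ((∏ b : Fin q, rename
          (Prod.map (fun i : Fin k => E (Sum.inl (b, i))) (fun i : Fin k => E (Sum.inl (b, i))))
          (perPoly (Fin k) ℝ≥0)) *
        ∏ x : Fin r, (X (E (Sum.inr x), E (Sum.inr x)) : MvPolynomial (Fin n × Fin n) ℝ≥0)) ∧
      P.size ≤ (q * (k * 2 ^ k) + q) + r + 1 := by
    refine exists_isMonotoneComputation_mul ?_ ?_
    · have h := exists_isMonotoneComputation_prod_fin (σ := Fin n × Fin n)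
        (fun b : Fin q => rename
          (Prod.map (fun i : Fin k => E (Sum.inl (b, i))) (fun i : Fin k => E (Sum.inl (b, i))))
          (perPoly (Fin k) ℝ≥0))
        (fun _ => k * 2 ^ k)
        (fun b => exists_isMonotoneComputation_rename
          ⟨JerrumSnir.laplaceCircuit hk0, (JerrumSnir.laplaceCircuit_spec hk0).1,
            size_laplaceCircuit_le hk0⟩ _)
      simpa using h
    · have h := exists_isMonotoneComputation_prod_fin (σ := Fin n × Fin n)
        (fun x : Fin r => (X (E (Sum.inr x), E (Sum.inr x)) : MvPolynomial (Fin n × Fin n) ℝ≥0))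
        (fun _ => 0) (fun x => exists_isMonotoneComputation_X _)
      simpa using h
  obtain ⟨P, ⟨hP1, hP2, hP3⟩, hPs⟩ := hcomp
  refine ⟨P, _, ⟨hP1, fun args hargs => hP2 _ hargs, hP3⟩, ?_, support_blockWitness_subset E, ?_⟩
  · -- size ≤ n^5 + 5
    refine hPs.trans ?_
    rw [← hqr]
    exact blockSize_le hk0 (hqr.symm ▸ h2k) (hqr.symm ▸ hn)
  · -- 2^{n log₂log₂ n - 5 n} ≤ |mon(g)|
    have hcard := factorial_pow_le_card_support_blockWitness (α := Fin n) E
    have hnat := succ_pow_le_two_pow_mul_factorial_pow (q := q) hk0 hrk (hqr.symm ▸ h2k)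
    rw [hqr] at hnat
    exact two_rpow_loglog_le (by omega) hlog hnat hcard

end Main

end Summit.ValiantsHypothesis.Theorems.SummationBits
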